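import Literature.AnabelianGeometry.SemiGraphs.CoveringRestrictComparisonProofs2
import Literature.AnabelianGeometry.SemiGraphs.MatchedStabilizersOfRestrictGlobal
import Literature.AnabelianGeometry.SemiGraphs.Corollary27iAtCoveringHomCan
import Literature.AnabelianGeometry.SemiGraphs.CommensurabilityProp25iProofs
import Literature.AnabelianGeometry.SemiGraphs.CoveringLift
import HarnessLib

/-!
# [SemiAnbd] Corollary 2.7 (i), Remark 2.7.2, Corollary 2.7 (ii) — second, independent proof via (RS)

Mochizuki, *Semi-graphs of anabelioids*, Publ. RIMS **42** (2006) 221–322, §2, Corollary 2.7 (i)/(ii)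
p. 30 and Remark 2.7.2 p. 30 [cite: MochizukiSemiAnbd2006, Cor. 2.7(i) p.30]: for a connected,
quasi-coherent graph of anabelioids `𝒢` and connected sub-graphs `ℍ` all of whose vertices are elevated,
`C_{Π_𝒢}(Π_ℍ) = Π_ℍ`; in particular `C_{Π_𝒢}(Π_v) = Π_v` for elevated `v`; the consequences Rmk. 2.7.2
(commensurable terminality in every intermediate `J`) and Cor. 2.7 (ii) (relative slimness, with
Prop. 2.5 (i)).

abc-iut cell, layer L3, the (ASM) file of the D3b four-way cut (ruling α7-1/α13-1; abc-iut-w5-d041).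
PROOF-ONLY (no definitions, no new named facts).  Assembly, by name:

* abc-iut-L3-d3's RS-cov `BObj.restrict_isGlobalCoveringOf` (`CoveringRestrictComparisonProofs2.lean`):
  the restricted covering `𝒢_A|_K → 𝒢|_ℍ` is GLOBALLY the covering attached to the sub-object
  `Z_K ↪ A|_ℍ` — packaged here as `restrictGlobal_coveringHomCan` in the (RS) binder shape of
  `subgraphComponents_doubleCosets_coveringHomCan_of_restrictGlobal`
  (`MatchedStabilizersOfRestrictGlobal.lean`, abc-iut-w5-d041; adapter: a preimage component is clopen in
  the preimage — abc-iut-L3-d3's `BObj.isClopenIn_of_isPreimageComponent` — and the two indexings of the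
  fibre characterisation of `Z_K` agree);
* hence (D3) at the covering of record for Galois objects (matched stabilizers, abc-iut-w5-d041, over
  abc-iut-L6-t17's bridge/transport and abc-iut-w4-d071's tautological point);
* hence abc-iut-w4-d071's closers `corollary_2_7_i_of_subgraphComponents_doubleCosets_coveringHomCan`,
  `remark_2_7_2_…`, `corollary_2_7_ii_of_prop25i_…` (`Corollary27iAtCoveringHomCan.lean`) fire, the last
  one with abc-iut-L3's `proposition_2_5_i_holds`.

So the named facts `corollary_2_7_i`, `remark_2_7_2`, `corollary_2_7_ii` (`Commensurability.lean`,
abc-iut-L3-t1) are kernel theorems with NO residual hypothesis.  This is the SECOND, INDEPENDENT proof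
(via abc-iut-L3-d3's restriction equivalence (RS)); the FIRST landed proof — which owns the canonical names
`corollary_2_7_i_holds` / `remark_2_7_2_holds` / `corollary_2_7_ii_holds` by abc-iut-L3-lead's ruling α24-2 —
is abc-iut-w4-d071's `Corollary27iHoldsViaDecompositionGroups.lean` (decomposition groups of the restricted
coverings, (CORE)+(COMP)); hence the primed names here.  Nothing here takes a side on [IUTchIII] Cor. 3.12.
-/

namespace Literature.AnabelianGeometry.SemiGraphs

namespace SemiGraphOfAnabelioids

open CategoryTheory CategoryTheory.Limits CategoryTheory.Functor CategoryTheory.PreGaloisCategory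
open Literature.AnabelianGeometry.Anabelioids
open scoped Pointwise

universe v₁ u₁ u


/-! ### A. (RS) for the covering of record, in the binder shape of the matched-stabilizer reduction -/

/-- **(RS), the global clause of the restricted coverings — PROVED** (abc-iut-L3-d3's
`BObj.restrict_isGlobalCoveringOf`, re-indexed): for `𝒢` connected, `A` Galois with `𝒢_A` connected, a
connected sub-graph `ℍ`, a preimage component `K` and ANY sub-object `m : Z ↪ A|_ℍ` of `B(𝒢_ℍ)` with
the fibre images cut out by `K`, the restricted morphism `𝒢_A|_K → 𝒢|_ℍ` is globally the covering
attached to `Z`.  (The hypothesis shape is literally the one of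
`subgraphComponents_doubleCosets_coveringHomCan_of_restrictGlobal`.)
[cite: MochizukiSemiAnbd2006, Cor. 2.7(i) p.30] -/
theorem restrictGlobal_coveringHomCan :
    ∀ (𝒢 : SemiGraphOfAnabelioids.{v₁, u₁, u}) (A : 𝒢.BObj) (hc : 𝒢.IsConnected),
      @IsGalois 𝒢.BObj _ (𝒢.galoisCategory_bObj hc) A → A.coveringGraph.IsConnected →
      ∀ (H : 𝒢.graph.Subgraph), H.toSemiGraph.IsConnected → H.toSemiGraph.IsGraph →
      ∀ (K : {K : A.coveringGraph.graph.Subgraph // A.coveringHomCan.IsPreimageComponent H K})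
        (Z : (𝒢.restrict H).BObj) (m : Z ⟶ (𝒢.restrictFunctor H).obj A), Mono m →
        (∀ (w : H.toSemiGraph.Vertex) (Fw : 𝒢.V w.1 ⥤ FintypeCat.{v₁}) [FiberFunctor Fw]
            (y : Fw.obj (A.S w.1)),
          y ∈ Set.range (Fw.map (m.fS w)) ↔ ∃ P : π₀Obj (A.S w.1),
            (∃ w'' ∈ K.1.verts,
                (⟨A.fibreData.proj.vertexMap w'', A.vComp w''⟩ : Σ v, π₀Obj (A.S v)) = ⟨w.1, P⟩) ∧
              y ∈ Set.range (Fw.map P.1.arrow)) →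
        (∀ (e : H.toSemiGraph.Edge) (Fe : 𝒢.E e.1 ⥤ FintypeCat.{v₁}) [FiberFunctor Fe]
            (x : Fe.obj (A.T e.1)),
          x ∈ Set.range (Fe.map (m.fT e)) ↔ ∃ Q : π₀Obj (A.T e.1),
            (∃ e'' ∈ K.1.edges,
                (⟨A.fibreData.proj.edgeMap e'', A.eComp e''⟩ : Σ e, π₀Obj (A.T e)) = ⟨e.1, Q⟩) ∧
              x ∈ Set.range (Fe.map Q.1.arrow)) →
        (A.coveringHomCan.restrict K.1 H K.2.2.2.2.1 K.2.2.2.2.2.1).IsGlobalCoveringOf Z := by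
  intro 𝒢 A hc _ _ H hH hHg K Z m hm hmS hmT
  haveI := hm
  letI := (𝒢.restrict H).preGaloisCategory_bObj
  haveI : HasBinaryProducts (𝒢.restrict H).BObj := (𝒢.restrict H).hasBinaryProducts_bObj
  -- the two indexings of the fibre characterisation of `Z` agree
  have hmS' : ∀ (w : H.toSemiGraph.Vertex) (Fw : 𝒢.V w.1 ⥤ FintypeCat.{v₁}) [FiberFunctor Fw]
      (y : Fw.obj (A.S w.1)),
      y ∈ Set.range (Fw.map (m.fS w)) ↔ ∃ c : Shrink.{u} (π₀Obj (A.S w.1)),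
        (⟨w.1, c⟩ : A.fibreData.total.Vertex) ∈ K.1.verts ∧
          y ∈ Set.range (Fw.map (A.vComp ⟨w.1, c⟩).1.arrow) := by
    intro w Fw _ y
    rw [hmS w Fw y]
    constructor
    · rintro ⟨P, ⟨⟨u, c⟩, hw'', heq⟩, hy⟩
      obtain ⟨hu, hP⟩ := Sigma.mk.inj_iff.mp heq
      change u = w.1 at hu
      subst hu
      refine ⟨c, hw'', ?_⟩
      rw [eq_of_heq hP]
      exact hy
    · rintro ⟨c, hc, hy⟩
      exact ⟨A.vComp ⟨w.1, c⟩, ⟨⟨w.1, c⟩, hc, rfl⟩, hy⟩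
  have hmT' : ∀ (e : H.toSemiGraph.Edge) (Fe : 𝒢.E e.1 ⥤ FintypeCat.{v₁}) [FiberFunctor Fe]
      (x : Fe.obj (A.T e.1)),
      x ∈ Set.range (Fe.map (m.fT e)) ↔ ∃ c : Shrink.{u} (π₀Obj (A.T e.1)),
        (⟨e.1, c⟩ : A.fibreData.total.Edge) ∈ K.1.edges ∧
          x ∈ Set.range (Fe.map (A.eComp ⟨e.1, c⟩).1.arrow) := by
    intro e Fe _ x
    rw [hmT e Fe x]
    constructor
    · rintro ⟨Q, ⟨⟨f, c⟩, he'', heq⟩, hx⟩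
      obtain ⟨hf, hQ⟩ := Sigma.mk.inj_iff.mp heq
      change f = e.1 at hf
      subst hf
      refine ⟨c, he'', ?_⟩
      rw [eq_of_heq hQ]
      exact hx
    · rintro ⟨c, hc, hx⟩
      exact ⟨A.eComp ⟨e.1, c⟩, ⟨⟨e.1, c⟩, hc, rfl⟩, hx⟩
  exact A.restrict_isGlobalCoveringOf H K.1 K.2.2.2.2.1 K.2.2.2.2.2.1
    (A.isClopenIn_of_isPreimageComponent H K.1 hHg K.2) m hmS' hmT' hH

/-! ### B. The named facts -/

/-- **[SemiAnbd] Corollary 2.7 (i), PROVED (second independent proof, via (RS)/restriction; first: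
abc-iut-w4-d071's `corollary_2_7_i_holds`)**: the named fact `corollary_2_7_i` (`Commensurability.lean`)
— `C_{Π_𝒢}(Π_ℍ) = Π_ℍ` for connected sub-graphs `ℍ` with elevated vertices of a connected quasi-coherent
graph of anabelioids, and `C_{Π_𝒢}(Π_v) = Π_v` for elevated `v`.
[cite: MochizukiSemiAnbd2006, Cor. 2.7(i) p.30] -/
theorem corollary_2_7_i_holds'.{v₂, u₂, u₃} : corollary_2_7_i.{v₂, u₂, u₃} :=
  corollary_2_7_i_of_subgraphComponents_doubleCosets_coveringHomCan
    (subgraphComponents_doubleCosets_coveringHomCan_of_restrictGlobal restrictGlobal_coveringHomCan)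

/-- **[SemiAnbd] Remark 2.7.2, PROVED (second independent proof, via (RS); first: `remark_2_7_2_holds`)**:
the named fact `remark_2_7_2` (commensurable terminality of
`Π_v` in every subgroup `J ⊇ Π_v`). [cite: MochizukiSemiAnbd2006, Rem. 2.7.2 p.30] -/
theorem remark_2_7_2_holds'.{v₂, u₂, u₃} : remark_2_7_2.{v₂, u₂, u₃} :=
  remark_2_7_2_of_subgraphComponents_doubleCosets_coveringHomCan
    (subgraphComponents_doubleCosets_coveringHomCan_of_restrictGlobal restrictGlobal_coveringHomCan)

/-- **[SemiAnbd] Corollary 2.7 (ii), PROVED (second independent proof, via (RS); first: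
`corollary_2_7_ii_holds`)**: the named fact `corollary_2_7_ii` (relative slimness of
`B(𝒢_ℍ) → B(𝒢)` when `ℍ` contains a vertex with slim `𝒢_v`; in particular `B(𝒢)` is slim), with
Prop. 2.5 (i) supplied by `proposition_2_5_i_holds`. [cite: MochizukiSemiAnbd2006, Cor. 2.7(ii) p.30] -/
theorem corollary_2_7_ii_holds'.{v₂, u₂, u₃} : corollary_2_7_ii.{v₂, u₂, u₃} :=
  corollary_2_7_ii_of_prop25i_subgraphComponents_doubleCosets_coveringHomCan proposition_2_5_i_holds
    (subgraphComponents_doubleCosets_coveringHomCan_of_restrictGlobal restrictGlobal_coveringHomCan)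

end SemiGraphOfAnabelioids

end Literature.AnabelianGeometry.SemiGraphs
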